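import Mathlib.ModelTheory.Basic
import Mathlib.Logic.Equiv.Fin.Basic
import Mathlib.Data.Fin.Tuple.Basic
import Mathlib.Data.Finite.Prod
import Mathlib.Data.Finite.Sigma
import Mathlib.Data.Finite.Sum
import Mathlib.Data.Fintype.EquivFin
import Mathlib.SetTheory.Cardinal.Finite
import Literature.Computability.Complexity.Reductions
import Literature.ModelTheory.FiniteModelTheory.ESO
import Literature.ModelTheory.FiniteModelTheory.CohomologicalConsistencyLimits
import HarnessLib

/-!
# Primitive positive formulas, pp-interpretations, pp-powers and pp-constructibility

Topic `Literature/ModelTheory/FiniteModelTheory`; definition request `defn-PPInterpretation`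
(route PneNP/DescentTower, informal support `TransferUnderGadgets`). Source: L. Barto,
J. Opršal, M. Pinsker, *The wonderland of reflections* [BartoOprsalPinsker2017] §2–3
(numbering of arXiv:1510.04521 = Israel J. Math. 223 (2018)).

* `PPFormula L k` — a primitive positive formula with `k` free variables over the first-order
  language `L` (Mathlib `FirstOrder.Language`), in prenex form `∃ ȳ ⋀ atoms`, the atoms being
  `R(z̄)` (a relation symbol applied to variables) and `z = z'` [§2.2: "predicates, conjunction,
  equality, existential quantification"]; `PPFormula.Realize`; `Realize.map` (homomorphisms
  preserve pp-formulas, proved); `IsPPDefinable` [§2.4].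
* `HomEquivalent L M N` [§2.5]; `HomEquivalent.nonempty_hom_iff` (= Prop. 3.2, proved);
  `InCSP L A C` — "`C ∈ CSP(A)`", `C` maps homomorphically to the template `A` [§2.2] (any
  types; for table templates `T : RelTables ar m` and table instances this is the tree's
  `HasHomTo`/`cspClass`/`cspLanguage T` of `CohomologicalConsistencyLimits.lean`, reused).
* `PPInterpretation L₁ L₂ M N` — a pp-interpretation of the `L₂`-structure `N` in the
  `L₁`-structure `M` [§2.4]: a dimension `n ≥ 1`, a partial surjection `f` from `dom ⊆ Mⁿ` onto
  `N`, and pp-formulas defining `dom`, the kernel of `f` (a `2n`-ary relation on `M`) and the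
  preimage of every relation of `N` (a `kn`-ary relation on `M`); `PPInterprets`.
* `PPPower L₁ L₂ n` — the data of an `n`-th pp-power [Def. 3.6]: for each relation symbol of
  `L₂` of arity `k` a pp-formula over `L₁` with `kn` free variables; `PPPower.Carrier P M`
  (= `Fin n → M`) with its `L₂`-structure; `IsPPPowerOf`; `PPConstructs L₁ L₂ M N` — "`M`
  pp-constructs `N`": `N` is homomorphically equivalent to a pp-power of `M` [Def. 3.4 with
  Cor. 3.10]; `PPInterpretation.ppConstructs` (= Lemma 3.8 (i), proved).
* GADGET REPLACEMENT [proof of Prop. 3.1]: for `P : PPPower L₁ L₂ n` and an `L₂`-structure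
  (instance) `ι`, the `L₁`-structure `P.Gadget ι` — every element of `ι` becomes `n` variables,
  every constraint `R(x̄)` of `ι` a fresh copy of the pp-definition of `R` (fresh variables for
  its `∃`, variables identified along its equality atoms) — with the reduction property
  `nonempty_gadget_hom_iff : Nonempty (P.Gadget ι →[L₁] M) ↔ Nonempty (ι →[L₂] P.Carrier M)`
  (proved), finiteness (`Finite (P.Gadget ι)` for finite `ι` and finite relational signature),
  and the instance map on table instances `gadgetInstance : SNPInstance br → SNPInstance ar`
  with `gadgetInstance_inCSP_iff` / `hasHomTo_gadgetInstance_iff` (proved).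
* Named fact `cspLanguage_karpReducible_of_ppConstructs` [Cor. 3.5 with Cor. 3.10 and
  Prop. 3.1 (= Bulatov–Jeavons–Krokhin 2005)]: pp-constructibility gives a polynomial-time
  many-one reduction `CSP(N) ≤ₚ CSP(M)` (printed: log-space; the tree has no log-space
  reductions, `≤ₚ` is the weaker consequence), over non-degenerate instance vocabularies
  (`IsNondegenerateVocab`, as for `fagin_theorem` in `ESO.lean`). Nothing asserted.

## Design notes

* Tuples of tuples: a `k`-ary relation on `Mⁿ` "is regarded as a `kn`-ary relation on `M`"
  [§2.4] through `flatten : (Fin k → Fin n → M) → (Fin (k * n) → M)`, block by block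
  (`flatten t (finProdFinEquiv (i, j)) = t i j`, i.e. position `j + n i`).
* pp-formulas are taken in prenex normal form (a list of atoms under one block of `∃`); every
  pp-formula in the sense of §2.2 is logically equivalent to one of these, and the normal form
  is what gadget replacement consumes. Atoms apply relation symbols to VARIABLES: the notion is
  meant for relational signatures (`L.IsRelational`, as all CSP templates are); function
  symbols of `L`, if any, do not occur in pp-formulas here.
* `PPConstructs` is defined by the characterization Cor. 3.10 (ii) ("homomorphically
  equivalent to a pp-power"), which [BartoOprsalPinsker2017] prove equivalent to the sequential
  Def. 3.4 for all at most countable ω-categorical, in particular all finite, structures; the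
  requesting route uses exactly this form.
* Mathlib has first-order structures, homomorphisms `M →[L] N`, `BoundedFormula` with
  `IsAtomic/IsQF/IsUniversal/IsExistential`, but no positive/conjunctive fragment, no
  pp-definability, interpretations or CSP templates (searched `PrimitivePositive`, `ppDefin`,
  `Interpretation`, `HomEquiv`, `CSP`); the tree has MaxCSP instances
  (`Literature.Computability.Complexity.CSPInstance`, unrelated format) and the table
  vocabularies `relLanguage`/`RelTables`/`SNPInstance` (`SNP.lean`, reused here).
* Deliberately NOT here: "`K₃` pp-constructs every finite structure" (Greenwell–Lovász /
  Bulatov–Jeavons–Krokhin; no held source states it — follow-up cite item), composition of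
  pp-interpretations as data, polymorphisms and Thm. 1.1/1.3 of the source.
-/

namespace Literature.ModelTheory.FiniteModelTheory

open scoped _root_.FirstOrder
open _root_.FirstOrder.Language (Structure IsRelational)
open _root_.FirstOrder.Language.Structure (RelMap)

universe u v u' v' w w'

/-! ### Tuples of tuples -/

section Flatten

variable {α β : Type*} {k n : ℕ}

/-- A `k`-tuple of `n`-tuples as a `kn`-tuple, block by block: position `j + n·i` holds
`t i j`. ("a `k`-ary relation on `Aⁿ` is regarded as a `kn`-ary relation on `A`")
[cite: BartoOprsalPinsker2017, §2.4] -/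
def flatten (t : Fin k → Fin n → α) : Fin (k * n) → α :=
  fun p => t p.divNat p.modNat

/-- `flatten t` at position `finProdFinEquiv (i, j) = j + n i` is `t i j`. [folklore] -/
@[simp] theorem flatten_finProdFinEquiv (t : Fin k → Fin n → α) (i : Fin k) (j : Fin n) :
    flatten t (finProdFinEquiv (i, j)) = t i j := by
  have h := finProdFinEquiv.symm_apply_apply (i, j)
  rw [finProdFinEquiv_symm_apply, Prod.mk.injEq] at h
  simp only [flatten, h.1, h.2]

/-- `flatten` commutes with post-composition. [folklore] -/
theorem comp_flatten (f : α → β) (t : Fin k → Fin n → α) :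
    f ∘ flatten t = flatten (fun i => f ∘ t i) := rfl

/-- `Fin.append` commutes with post-composition. [folklore] -/
theorem comp_append {m : ℕ} (f : α → β) (v : Fin m → α) (w : Fin n → α) :
    f ∘ Fin.append v w = Fin.append (f ∘ v) (f ∘ w) := by
  funext i
  refine Fin.addCases (fun i => ?_) (fun i => ?_) i <;> simp

end Flatten

/-! ### Primitive positive formulas -/

/-- **A primitive positive formula** with `k` free variables over `L`, in prenex normal form
`∃ y₀ … y_{e-1} ⋀ atoms`: the number `e = numExists` of existentially quantified variables,
the relational atoms `R(z₁, …, z_l)` (`rels`: a relation symbol of arity `l` applied to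
variables among the `k + e` variables, free ones first) and the equality atoms `z = z'`
(`eqs`). [BOP, §2.2: "a pp-formula … only uses predicates, conjunction, equality, and
existential quantification"] [cite: BartoOprsalPinsker2017, §2.2] -/
structure PPFormula (L : FirstOrder.Language.{u, v}) (k : ℕ) where
  /-- The number of existentially quantified variables. -/
  numExists : ℕ
  /-- The relational atoms `R(z̄)`. -/
  rels : List (Σ l : ℕ, L.Relations l × (Fin l → Fin (k + numExists)))
  /-- The equality atoms `z = z'`. -/
  eqs : List (Fin (k + numExists) × Fin (k + numExists))

namespace PPFormula

variable {L : FirstOrder.Language.{u, v}} {k : ℕ}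
variable {M : Type w} [L.Structure M] {N : Type w'} [L.Structure N]

/-- Semantics: `φ(v)` holds in `M` iff some witnesses `w` for the quantified variables satisfy
every atom under the assignment `Fin.append v w`. [cite: BartoOprsalPinsker2017, §2.2] -/
def Realize (φ : PPFormula L k) (v : Fin k → M) : Prop :=
  ∃ w : Fin φ.numExists → M,
    (∀ a ∈ φ.rels, RelMap a.2.1 (Fin.append v w ∘ a.2.2)) ∧
      ∀ e ∈ φ.eqs, Fin.append v w e.1 = Fin.append v w e.2

/-- The atomic pp-formula `R(x_{f 0}, …, x_{f (l-1)})` in `k` free variables. [folklore] -/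
def atomWith {l : ℕ} (R : L.Relations l) (f : Fin l → Fin k) : PPFormula L k :=
  ⟨0, [⟨l, R, Fin.castAdd 0 ∘ f⟩], []⟩

/-- `R(x_{f 0}, …)` holds at `v` iff `v ∘ f ∈ R`. [folklore] -/
@[simp] theorem realize_atomWith {l : ℕ} (R : L.Relations l) (f : Fin l → Fin k)
    (v : Fin k → M) : (atomWith R f).Realize v ↔ RelMap R (v ∘ f) := by
  have key : ∀ w : Fin (atomWith R f).numExists → M,
      Fin.append v w ∘ (Fin.castAdd 0 ∘ f) = v ∘ f :=
    fun w => funext fun i => Fin.append_left v w (f i)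
  constructor
  · rintro ⟨w, hr, -⟩
    exact (congrArg (RelMap R) (key w)).mp (hr _ (List.mem_singleton_self _))
  · intro h
    refine ⟨Fin.elim0, fun a ha => ?_, fun e he => absurd he List.not_mem_nil⟩
    obtain rfl : a = ⟨l, R, Fin.castAdd 0 ∘ f⟩ := List.mem_singleton.1 ha
    exact (congrArg (RelMap R) (key Fin.elim0)).mpr h

/-- The atomic pp-formula `R(x₀, …, x_{k-1})`. [folklore] -/
def atom (R : L.Relations k) : PPFormula L k :=
  atomWith R id

/-- `R(x̄)` holds at `v` iff `v ∈ R`. [folklore] -/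
@[simp] theorem realize_atom (R : L.Relations k) (v : Fin k → M) :
    (atom R).Realize v ↔ RelMap R v :=
  realize_atomWith R id v

/-- The equality atom `x_i = x_j` as a pp-formula. [folklore] -/
def eq (i j : Fin k) : PPFormula L k :=
  ⟨0, [], [(Fin.castAdd 0 i, Fin.castAdd 0 j)]⟩

/-- `(x_i = x_j)(v)` iff `v i = v j`. [folklore] -/
@[simp] theorem realize_eq (i j : Fin k) (v : Fin k → M) :
    (eq i j : PPFormula L k).Realize v ↔ v i = v j := by
  have key : ∀ (w : Fin (eq i j : PPFormula L k).numExists → M) (i : Fin k),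
      Fin.append v w (Fin.castAdd 0 i) = v i := fun w i => Fin.append_left v w i
  constructor
  · rintro ⟨w, -, he⟩
    rw [← key w i, ← key w j]
    exact he _ (List.mem_singleton_self _)
  · intro h
    refine ⟨Fin.elim0, fun a ha => absurd ha List.not_mem_nil, fun e he => ?_⟩
    obtain rfl : e = (Fin.castAdd 0 i, Fin.castAdd 0 j) := List.mem_singleton.1 he
    rw [key, key]
    exact h

/-- The true pp-formula (no atoms). [folklore] -/
def top : PPFormula L k :=
  ⟨0, [], []⟩

/-- `top` holds everywhere. [folklore] -/
@[simp] theorem realize_top (v : Fin k → M) : (top : PPFormula L k).Realize v :=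
  ⟨Fin.elim0, fun _ ha => absurd ha List.not_mem_nil, fun _ he => absurd he List.not_mem_nil⟩

/-- **Homomorphisms preserve pp-formulas**: if `φ(v)` holds in `M` and `f : M → N` is a
homomorphism then `φ(f ∘ v)` holds in `N`. [BOP, §3.1, before Prop. 3.2]
[cite: BartoOprsalPinsker2017, §3.1] -/
theorem Realize.map {φ : PPFormula L k} {v : Fin k → M} (h : φ.Realize v) (f : M →[L] N) :
    φ.Realize (f ∘ v) := by
  obtain ⟨w, hr, he⟩ := h
  refine ⟨f ∘ w, fun a ha => ?_, fun e he' => ?_⟩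
  · rw [← comp_append, Function.comp_assoc]
    exact f.map_rel a.2.1 _ (hr a ha)
  · simp only [← comp_append, Function.comp_apply, he e he']

end PPFormula

/-- A `k`-ary relation `S ⊆ Mᵏ` is **pp-definable** in the `L`-structure `M` (without
parameters). [cite: BartoOprsalPinsker2017, §2.4] -/
def IsPPDefinable (L : FirstOrder.Language.{u, v}) {M : Type w} [L.Structure M] {k : ℕ}
    (S : Set (Fin k → M)) : Prop :=
  ∃ φ : PPFormula L k, ∀ v, φ.Realize v ↔ v ∈ S

/-! ### Homomorphic equivalence and `CSP(A)` -/

/-- `M` and `N` (same signature) are **homomorphically equivalent**: there are homomorphisms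
`M → N` and `N → M`. [cite: BartoOprsalPinsker2017, §2.5] -/
def HomEquivalent (L : FirstOrder.Language.{u, v}) (M : Type w) (N : Type w') [L.Structure M]
    [L.Structure N] : Prop :=
  Nonempty (M →[L] N) ∧ Nonempty (N →[L] M)

namespace HomEquivalent

variable {L : FirstOrder.Language.{u, v}} {M : Type w} {N : Type w'} [L.Structure M]
  [L.Structure N]

/-- Homomorphic equivalence is symmetric. [folklore] -/
theorem symm (h : HomEquivalent L M N) : HomEquivalent L N M := ⟨h.2, h.1⟩

/-- **Prop. 3.2**: homomorphically equivalent structures have the same CSP — a structure `C`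
maps homomorphically to `M` iff it maps homomorphically to `N`.
[cite: BartoOprsalPinsker2017, Prop. 3.2] -/
theorem nonempty_hom_iff (h : HomEquivalent L M N) (C : Type*) [L.Structure C] :
    Nonempty (C →[L] M) ↔ Nonempty (C →[L] N) :=
  ⟨fun ⟨g⟩ => h.1.map fun f => f.comp g, fun ⟨g⟩ => h.2.map fun f => f.comp g⟩

end HomEquivalent

/-- `C ∈ CSP(A)`: the instance `C` maps homomorphically to the template `A`.
[cite: BartoOprsalPinsker2017, §2.2] -/
def InCSP (L : FirstOrder.Language.{u, v}) (A : Type w) [L.Structure A] (C : Type w')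
    [L.Structure C] : Prop :=
  Nonempty (C →[L] A)

/-! ### pp-interpretations -/

/-- **A pp-interpretation of `N` in `M`** ("`M` pp-interprets `N`"), `M` an `L₁`-structure and
`N` an `L₂`-structure: a dimension `n ≥ 1`, a map `f` from a subset `dom ⊆ Mⁿ` ONTO `N`, and
pp-formulas over `L₁` defining (i) `dom`, (ii) the preimage of equality on `N` under `f` as a
`2n`-ary relation on `M`, (iii) the preimage under `f` of every relation `R` of `N`, a `k`-ary
`R` giving a `kn`-ary relation on `M` (`flatten`). [cite: BartoOprsalPinsker2017, §2.4] -/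
structure PPInterpretation (L₁ : FirstOrder.Language.{u, v}) (L₂ : FirstOrder.Language.{u', v'})
    (M : Type w) (N : Type w') [L₁.Structure M] [L₂.Structure N] where
  /-- The dimension `n`. -/
  dim : ℕ
  /-- `n ≥ 1`. -/
  one_le_dim : 1 ≤ dim
  /-- The domain of the partial map `f : Mⁿ ⇀ N`. -/
  dom : Set (Fin dim → M)
  /-- The map `f`, on its domain. -/
  toFun : dom → N
  /-- `f` is onto `N`. -/
  surjective : Function.Surjective toFun
  /-- A pp-definition of `dom`. -/
  domFormula : PPFormula L₁ dim
  /-- A pp-definition of the kernel `{(a, b) ∈ dom² | f a = f b}` (a `2n`-ary relation). -/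
  kerFormula : PPFormula L₁ (dim + dim)
  /-- A pp-definition of `f⁻¹(R) ⊆ domᵏ` (a `kn`-ary relation) for each relation symbol `R`. -/
  relFormula : ∀ {l : ℕ}, L₂.Relations l → PPFormula L₁ (l * dim)
  /-- `domFormula` defines exactly `dom`. -/
  realize_domFormula_iff : ∀ a, domFormula.Realize a ↔ a ∈ dom
  /-- `kerFormula(a, b)` iff `a, b ∈ dom` and `f a = f b`. -/
  realize_kerFormula_iff : ∀ a b, kerFormula.Realize (Fin.append a b) ↔
    ∃ (ha : a ∈ dom) (hb : b ∈ dom), toFun ⟨a, ha⟩ = toFun ⟨b, hb⟩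
  /-- `relFormula R (t₁, …, t_k)` iff all `tᵢ ∈ dom` and `R(f t₁, …, f t_k)` holds in `N`. -/
  realize_relFormula_iff : ∀ {l : ℕ} (R : L₂.Relations l) (t : Fin l → Fin dim → M),
    (relFormula R).Realize (flatten t) ↔ ∃ h : ∀ i, t i ∈ dom, RelMap R fun i => toFun ⟨t i, h i⟩

/-- **Every structure pp-interprets itself**: dimension `1`, `f(a) = a₀` on all of `M¹`,
`dom` defined by the true formula, the kernel by `x₀ = x₁`, and `R` by `R(x₀, …, x_{k-1})`.
[folklore] -/
def PPInterpretation.refl (L : FirstOrder.Language.{u, v}) (M : Type w) [L.Structure M] :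
    PPInterpretation L L M M where
  dim := 1
  one_le_dim := le_rfl
  dom := Set.univ
  toFun a := a.1 0
  surjective b := ⟨⟨fun _ => b, trivial⟩, rfl⟩
  domFormula := PPFormula.top
  kerFormula := PPFormula.eq 0 1
  relFormula R := PPFormula.atomWith R fun i => finProdFinEquiv (i, 0)
  realize_domFormula_iff a := by simp
  realize_kerFormula_iff a b := by
    have h0 : Fin.append a b 0 = a 0 := Fin.append_left a b 0
    have h1 : Fin.append a b 1 = b 0 := Fin.append_right a b 0
    simp [h0, h1]
  realize_relFormula_iff R t := by
    refine (PPFormula.realize_atomWith R _ _).trans ?_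
    simp only [Function.comp_def, flatten_finProdFinEquiv]
    exact ⟨fun h => ⟨fun _ => trivial, h⟩, fun ⟨_, h⟩ => h⟩

/-- `M` **pp-interprets** `N` (`N` is pp-interpretable in `M`). [cite: BartoOprsalPinsker2017, §2.4] -/
def PPInterprets (L₁ : FirstOrder.Language.{u, v}) (L₂ : FirstOrder.Language.{u', v'})
    (M : Type w) (N : Type w') [L₁.Structure M] [L₂.Structure N] : Prop :=
  Nonempty (PPInterpretation L₁ L₂ M N)

/-- pp-interpretability is reflexive. [folklore] -/
theorem PPInterprets.refl (L : FirstOrder.Language.{u, v}) (M : Type w) [L.Structure M] :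
    PPInterprets L L M M :=
  ⟨PPInterpretation.refl L M⟩

/-! ### pp-powers and pp-constructibility -/

/-- **The data of an `n`-th pp-power** of an `L₁`-structure in the signature `L₂`: for every
relation symbol `R` of `L₂`, of arity `k`, a pp-formula over `L₁` with `kn` free variables
defining `R` on `n`-tuples. [cite: BartoOprsalPinsker2017, Def. 3.6] -/
structure PPPower (L₁ : FirstOrder.Language.{u, v}) (L₂ : FirstOrder.Language.{u', v'})
    (n : ℕ) where
  /-- The pp-definition of the relation `R` on `n`-tuples (a `kn`-ary relation). -/
  relFormula : ∀ {l : ℕ}, L₂.Relations l → PPFormula L₁ (l * n)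

namespace PPPower

variable {L₁ : FirstOrder.Language.{u, v}} {L₂ : FirstOrder.Language.{u', v'}} {n : ℕ}

/-- The universe `Mⁿ` of the pp-power `P` of `M` (a type synonym of `Fin n → M` carrying the
`L₂`-structure below). [cite: BartoOprsalPinsker2017, Def. 3.6] -/
def Carrier (_P : PPPower L₁ L₂ n) (M : Type w) : Type w := Fin n → M

/-- The `L₂`-structure of the pp-power: `R(t₁, …, t_k)` iff the pp-formula of `R` holds at the
`kn`-tuple `flatten t`. [cite: BartoOprsalPinsker2017, Def. 3.6] -/
instance instStructureCarrier (P : PPPower L₁ L₂ n) (M : Type w) [L₁.Structure M]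
    [L₂.IsRelational] : L₂.Structure (P.Carrier M) where
  RelMap := fun R t => (P.relFormula R).Realize (M := M) (flatten t)

/-- Unfolding of the relations of a pp-power. [cite: BartoOprsalPinsker2017, Def. 3.6] -/
@[simp] theorem relMap_carrier_iff (P : PPPower L₁ L₂ n) {M : Type w} [L₁.Structure M]
    [L₂.IsRelational] {l : ℕ} (R : L₂.Relations l) (t : Fin l → Fin n → M) :
    RelMap (M := P.Carrier M) R t ↔ (P.relFormula R).Realize (M := M) (flatten t) :=
  Iff.rfl

end PPPower

/-- `N` **is a pp-power of** `M`: `N` is isomorphic to the `L₂`-structure on some `Mⁿ`, `n ≥ 1`,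
whose relations are pp-definable from `M`. [cite: BartoOprsalPinsker2017, Def. 3.6] -/
def IsPPPowerOf (L₁ : FirstOrder.Language.{u, v}) (L₂ : FirstOrder.Language.{u', v'})
    [L₂.IsRelational] (M : Type w) (N : Type w') [L₁.Structure M] [L₂.Structure N] : Prop :=
  ∃ n : ℕ, 1 ≤ n ∧ ∃ P : PPPower L₁ L₂ n, Nonempty (N ≃[L₂] P.Carrier M)

/-- `M` **pp-constructs** `N` (`N` can be pp-constructed from `M`): `N` is homomorphically
equivalent to a pp-power of `M` — the characterization (ii) of Cor. 3.10, equivalent to the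
sequential Def. 3.4 (finitely many steps of pp-interpretation, homomorphic equivalence,
singleton expansion of cores) for all at most countable ω-categorical structures.
[cite: BartoOprsalPinsker2017, Def. 3.4 and Cor. 3.10] -/
def PPConstructs (L₁ : FirstOrder.Language.{u, v}) (L₂ : FirstOrder.Language.{u', v'})
    [L₂.IsRelational] (M : Type w) (N : Type w') [L₁.Structure M] [L₂.Structure N] : Prop :=
  ∃ n : ℕ, 1 ≤ n ∧ ∃ P : PPPower L₁ L₂ n, HomEquivalent L₂ N (P.Carrier M)

/-- A pp-power of `M` is pp-constructed by `M`. [cite: BartoOprsalPinsker2017, Cor. 3.10] -/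
theorem IsPPPowerOf.ppConstructs {L₁ : FirstOrder.Language.{u, v}}
    {L₂ : FirstOrder.Language.{u', v'}} [L₂.IsRelational] {M : Type w} {N : Type w'}
    [L₁.Structure M] [L₂.Structure N] (h : IsPPPowerOf L₁ L₂ M N) : PPConstructs L₁ L₂ M N := by
  obtain ⟨n, hn, P, ⟨e⟩⟩ := h
  exact ⟨n, hn, P, ⟨e.toHom⟩, ⟨e.symm.toHom⟩⟩

namespace PPInterpretation

variable {L₁ : FirstOrder.Language.{u, v}} {L₂ : FirstOrder.Language.{u', v'}}
  {M : Type w} {N : Type w'} [L₁.Structure M] [L₂.Structure N]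

/-- The pp-power underlying a pp-interpretation: universe `Mⁿ`, relations the `f`-preimages of
the relations of `N`. [cite: BartoOprsalPinsker2017, Lemma 3.8 (i), proof] -/
def toPPPower (I : PPInterpretation L₁ L₂ M N) : PPPower L₁ L₂ I.dim :=
  ⟨fun R => I.relFormula R⟩

/-- **Lemma 3.8 (i)** (`PpInt ⊆ HomEq PpPower`): if `M` pp-interprets a nonempty `N` then `N`
is homomorphically equivalent to the pp-power `I.toPPPower` of `M` (any total extension of `f`
is a homomorphism `Mⁿ → N`, any section of `f` one `N → Mⁿ`).
[cite: BartoOprsalPinsker2017, Lemma 3.8 (i)] -/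
theorem homEquivalent_toPPPower [L₂.IsRelational] [Nonempty N] (I : PPInterpretation L₁ L₂ M N) :
    HomEquivalent L₂ N (I.toPPPower.Carrier M) := by
  classical
  refine ⟨⟨⟨fun b => (Classical.choose (I.surjective b)).1, fun f => isEmptyElim f, ?_⟩⟩,
    ⟨⟨fun a => if h : a ∈ I.dom then I.toFun ⟨a, h⟩ else Classical.arbitrary N,
      fun f => isEmptyElim f, ?_⟩⟩⟩
  · intro l R b hb
    refine (I.realize_relFormula_iff R _).2 ⟨fun i => (Classical.choose (I.surjective (b i))).2, ?_⟩
    convert hb using 2 with i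
    exact Classical.choose_spec (I.surjective (b i))
  · intro l R t ht
    obtain ⟨h, hR⟩ := (I.realize_relFormula_iff R (fun i => t i)).1 ht
    convert hR using 2 with i
    simp only [Function.comp_apply]
    exact dif_pos (h i)

/-- Hence `M` pp-constructs every nonempty structure it pp-interprets.
[cite: BartoOprsalPinsker2017, Lemma 3.8 (i) with Cor. 3.10] -/
theorem ppConstructs [L₂.IsRelational] [Nonempty N] (I : PPInterpretation L₁ L₂ M N) :
    PPConstructs L₁ L₂ M N :=
  ⟨I.dim, I.one_le_dim, I.toPPPower, I.homEquivalent_toPPPower⟩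

end PPInterpretation

/-! ### Gadget replacement: the reduction `CSP(pp-power of M) → CSP(M)` -/

/-- A constraint of an instance `ι` (an `L₂`-structure): a tuple `x̄` in a relation `R` of `ι`.
[cite: BartoOprsalPinsker2017, §2.2] -/
structure Constraint (L₂ : FirstOrder.Language.{u', v'}) (ι : Type w) [L₂.Structure ι] where
  /-- The arity of the constraint. -/
  arity : ℕ
  /-- Its relation symbol. -/
  rel : L₂.Relations arity
  /-- Its scope `x̄`. -/
  args : Fin arity → ι
  /-- `R(x̄)` holds in `ι`. -/
  holds : RelMap rel args

namespace PPPower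

variable {L₁ : FirstOrder.Language.{u, v}} {L₂ : FirstOrder.Language.{u', v'}} {n : ℕ}
variable (P : PPPower L₁ L₂ n) (ι : Type w) [L₂.Structure ι]

/-- The variables of the gadget instance before identification: `n` copies `(x, j)` of every
element `x` of `ι`, and fresh variables `(c, j)`, `j < e_R`, for the quantified variables of
the pp-definition of `R` at every constraint `c = R(x̄)` of `ι`.
[cite: BartoOprsalPinsker2017, Prop. 3.1 (proof, after Bulatov–Jeavons–Krokhin)] -/
abbrev GadgetVar : Type (max v' w) :=
  (ι × Fin n) ⊕ (Σ c : Constraint L₂ ι, Fin (P.relFormula c.rel).numExists)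

/-- The assignment of the `kn + e_R` variables of the pp-definition of `R` at the constraint
`c = R(x₀, …, x_{k-1})`: free variable `j + n i ↦ (x_i, j)`, quantified variable `j ↦ (c, j)`.
[cite: BartoOprsalPinsker2017, Prop. 3.1 (proof)] -/
def gadgetAssign (c : Constraint L₂ ι) :
    Fin (c.arity * n + (P.relFormula c.rel).numExists) → P.GadgetVar ι :=
  Fin.append (flatten fun i j => Sum.inl (c.args i, j)) fun j => Sum.inr ⟨c, j⟩

/-- The identifications forced by the equality atoms of the gadgets.
[cite: BartoOprsalPinsker2017, Prop. 3.1 (proof)] -/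
def GadgetEq (a b : P.GadgetVar ι) : Prop :=
  ∃ c : Constraint L₂ ι, ∃ e ∈ (P.relFormula c.rel).eqs,
    P.gadgetAssign ι c e.1 = a ∧ P.gadgetAssign ι c e.2 = b

/-- **The gadget instance** `P.Gadget ι` of `CSP(M)` produced from the instance `ι` of
`CSP(P.Carrier M)`: the variables `GadgetVar` modulo the identifications `GadgetEq`, with the
`L₁`-structure `instStructureGadget`. [cite: BartoOprsalPinsker2017, Prop. 3.1 (proof)] -/
abbrev Gadget : Type (max v' w) :=
  Quot (P.GadgetEq ι)

/-- The relations of the gadget instance: `R₁(ū)` holds iff `ū` is the image of the variables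
of a relational atom `R₁(z̄)` of the gadget of some constraint of `ι`.
[cite: BartoOprsalPinsker2017, Prop. 3.1 (proof)] -/
instance instStructureGadget [L₁.IsRelational] : L₁.Structure (P.Gadget ι) where
  RelMap := fun {l} R u => ∃ c : Constraint L₂ ι,
    ∃ z : Fin l → Fin (c.arity * n + (P.relFormula c.rel).numExists),
      ⟨l, R, z⟩ ∈ (P.relFormula c.rel).rels ∧
        u = Quot.mk _ ∘ P.gadgetAssign ι c ∘ z

/-- The gadget instance of a finite instance over a finite relational signature is finite.
[cite: BartoOprsalPinsker2017, Prop. 3.1 (proof)] -/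
instance finite_gadget [Finite ι] [Finite (Σ l, L₂.Relations l)] : Finite (P.Gadget ι) := by
  haveI : Finite (Constraint L₂ ι) := by
    refine Finite.of_injective
      (fun c => (⟨⟨c.arity, c.rel⟩, c.args⟩ : Σ s : (Σ l, L₂.Relations l), Fin s.1 → ι)) ?_
    rintro ⟨l, R, x, hx⟩ ⟨l', R', x', hx'⟩ h
    simp only [Sigma.mk.injEq] at h
    obtain ⟨⟨rfl, hR⟩, hx⟩ := h
    subst hR; subst hx; rfl
  infer_instance

variable {ι}
variable {M : Type w'}

/-- The value of the gadget of `c` under a map `g` on variables.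
[cite: BartoOprsalPinsker2017, Prop. 3.1 (proof)] -/
theorem comp_gadgetAssign (g : P.GadgetVar ι → M) (c : Constraint L₂ ι) :
    g ∘ P.gadgetAssign ι c =
      Fin.append (flatten fun i j => g (Sum.inl (c.args i, j))) fun j => g (Sum.inr ⟨c, j⟩) := by
  rw [gadgetAssign, comp_append, comp_flatten]
  rfl

variable [L₁.Structure M]

/-- **The gadget reduction is correct** (Prop. 3.1 for pp-powers, structural part): the gadget
instance maps homomorphically to `M` iff the instance maps homomorphically to the pp-power
`P.Carrier M`. (→) read off the `n` copies of each element; (←) extend a homomorphism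
`h : ι → Mⁿ` by witnesses for the quantified variables of every gadget.
[cite: BartoOprsalPinsker2017, Prop. 3.1] -/
theorem nonempty_gadget_hom_iff [L₁.IsRelational] [L₂.IsRelational] :
    Nonempty (P.Gadget ι →[L₁] M) ↔ Nonempty (ι →[L₂] P.Carrier M) := by
  constructor
  · rintro ⟨g⟩
    refine ⟨⟨fun x j => g (Quot.mk _ (Sum.inl (x, j))), fun f => isEmptyElim f, ?_⟩⟩
    intro l R x hx
    let c : Constraint L₂ ι := ⟨l, R, x, hx⟩
    change (P.relFormula R).Realize (M := M) (flatten fun i j => g (Quot.mk _ (Sum.inl (x i, j))))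
    refine ⟨fun j => g (Quot.mk _ (Sum.inr ⟨c, j⟩)), ?_⟩
    have key : Fin.append (flatten fun i j => g (Quot.mk _ (Sum.inl (x i, j))))
        (fun j => g (Quot.mk _ (Sum.inr ⟨c, j⟩))) = (g ∘ Quot.mk _) ∘ P.gadgetAssign ι c :=
      (P.comp_gadgetAssign (g ∘ Quot.mk _) c).symm
    rw [key]
    exact ⟨fun a ha => g.map_rel a.2.1 _ ⟨c, a.2.2, ha, rfl⟩,
      fun e he => congrArg g (Quot.sound ⟨c, e, he, rfl, rfl⟩)⟩
  · rintro ⟨h⟩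
    have hc : ∀ c : Constraint L₂ ι, (P.relFormula c.rel).Realize (M := M) (flatten (h ∘ c.args)) :=
      fun c => h.map_rel c.rel c.args c.holds
    choose w hw using hc
    let g₀ : P.GadgetVar ι → M := Sum.elim (fun p => h p.1 p.2) fun s => w s.1 s.2
    have key : ∀ c : Constraint L₂ ι, g₀ ∘ P.gadgetAssign ι c = Fin.append (flatten (h ∘ c.args)) (w c) :=
      fun c => P.comp_gadgetAssign g₀ c
    have hg₀ : ∀ a b, P.GadgetEq ι a b → g₀ a = g₀ b := by
      rintro a b ⟨c, e, he, rfl, rfl⟩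
      have h1 := congrFun (key c) e.1
      have h2 := congrFun (key c) e.2
      simp only [Function.comp_apply] at h1 h2
      rw [h1, h2]
      exact (hw c).2 e he
    refine ⟨⟨Quot.lift g₀ hg₀, fun f => isEmptyElim f, ?_⟩⟩
    rintro l R u ⟨c, z, hz, rfl⟩
    have hc : Quot.lift g₀ hg₀ ∘ (Quot.mk (P.GadgetEq ι) ∘ P.gadgetAssign ι c ∘ z) =
        Fin.append (flatten (h ∘ c.args)) (w c) ∘ z := by
      rw [← key c]; rfl
    exact (congrArg (RelMap R) hc).mpr ((hw c).1 _ hz)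

/-- The gadget reduction in `CSP` terms. [cite: BartoOprsalPinsker2017, Prop. 3.1] -/
theorem inCSP_gadget_iff [L₁.IsRelational] [L₂.IsRelational] :
    InCSP L₁ M (P.Gadget ι) ↔ InCSP L₂ (P.Carrier M) ι :=
  P.nonempty_gadget_hom_iff

end PPPower

/-! ### The instance map on finite table instances -/

section Tables

open Literature.Computability.Cryptography

/-- A table vocabulary has finitely many relation symbols. [folklore] -/
instance finite_sigma_relations_relLanguage (ar : List ℕ) :
    Finite (Σ l, (relLanguage ar).Relations l) := by
  refine Finite.of_injective (fun s => s.2.1) ?_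
  rintro ⟨l, i, hi⟩ ⟨l', i', hi'⟩ (h : i = i')
  subst h; subst hi; subst hi'; rfl

variable {ar br : List ℕ} {n m : ℕ}

/-- For table templates and table instances `InCSP` is the tree's `HasHomTo`. [folklore] -/
theorem hasHomTo_iff_inCSP (R : RelTables br n) (T : RelTables br m) :
    HasHomTo R T ↔
      (letI := structureOfTables R; letI := structureOfTables T; InCSP (relLanguage br) (Fin m) (Fin n)) :=
  Iff.rfl

/-- **Gadget replacement on finite instances**: the finite `br`-instance `⟨N, R⟩` (tables on
`Fin N`) is sent to the tables, on `Fin N'` with `N' = |P.Gadget (Fin N)|`, of its gadget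
instance (transported along an enumeration `Finite.equivFin`; noncomputable only through the
choice of that enumeration). [cite: BartoOprsalPinsker2017, Prop. 3.1 (proof)] -/
noncomputable def gadgetInstance (P : PPPower (relLanguage ar) (relLanguage br) n)
    (x : SNPInstance br) : SNPInstance ar :=
  letI := structureOfTables x.2
  ⟨Nat.card (P.Gadget (Fin x.1)),
    tablesOfStructure (Equiv.inducedStructure (Finite.equivFin (P.Gadget (Fin x.1))))⟩

/-- The instance map is a reduction `CSP(P.Carrier A) → CSP(A)` on finite instances:
`gadgetInstance P x ∈ CSP(A) ↔ x ∈ CSP(P.Carrier A)`. [cite: BartoOprsalPinsker2017, Prop. 3.1] -/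
theorem gadgetInstance_inCSP_iff (P : PPPower (relLanguage ar) (relLanguage br) n)
    (x : SNPInstance br) (A : Type w) [(relLanguage ar).Structure A] :
    (letI := structureOfTables (gadgetInstance P x).2;
      InCSP (relLanguage ar) A (Fin (gadgetInstance P x).1)) ↔
      (letI := structureOfTables x.2; InCSP (relLanguage br) (P.Carrier A) (Fin x.1)) := by
  letI := structureOfTables x.2
  rw [← P.inCSP_gadget_iff]
  let eN : P.Gadget (Fin x.1) ≃ Fin (gadgetInstance P x).1 := Finite.equivFin (P.Gadget (Fin x.1))
  have hS : structureOfTables (gadgetInstance P x).2 = Equiv.inducedStructure eN :=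
    structureOfTables_tablesOfStructure _
  rw [hS]
  letI : (relLanguage ar).Structure (Fin (gadgetInstance P x).1) := Equiv.inducedStructure eN
  let e := Equiv.inducedStructureEquiv (L := relLanguage ar) eN
  exact ⟨fun ⟨g⟩ => ⟨g.comp e.toHom⟩, fun ⟨g⟩ => ⟨g.comp e.symm.toHom⟩⟩

/-- The instance map against a table template `T`: `gadgetInstance P x ∈ CSP(T)` (the tree's
`HasHomTo`/`cspClass`) iff `x ∈ CSP(P.Carrier (Fin m))`. [cite: BartoOprsalPinsker2017, Prop. 3.1] -/
theorem hasHomTo_gadgetInstance_iff (P : PPPower (relLanguage ar) (relLanguage br) n)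
    (x : SNPInstance br) (T : RelTables ar m) :
    HasHomTo (gadgetInstance P x).2 T ↔
      (letI := structureOfTables x.2; letI := structureOfTables T;
        InCSP (relLanguage br) (P.Carrier (Fin m)) (Fin x.1)) :=
  letI := structureOfTables T
  gadgetInstance_inCSP_iff P x (Fin m)

/-- NAMED FACT (**Cor. 3.5: pp-constructibility gives reductions**, polynomial-time form, finite
templates). If the template `T` (tables on `Fin m`, vocabulary `ar`) pp-constructs the template
`T'` (tables on `Fin m'`, vocabulary `br`) then `CSP(T')` many-one reduces to `CSP(T)` in
polynomial time: `cspLanguage T' ≤ₚ cspLanguage T` (the tree's `cspLanguage`,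
`CohomologicalConsistencyLimits.lean`). Printed for relational structures with finite signatures
and LOG-SPACE reductions (Prop. 3.1 = Bulatov–Jeavons–Krokhin 2005 for pp-interpretations,
Prop. 3.2 for homomorphic equivalence, Cor. 3.5/3.10 for pp-constructions); the tree has no
log-space reducibility, and `≤ₚ` (`Literature.Computability.Complexity.PolyTimeKarpReducible`) is
the weaker consequence; finite templates are the case the source's §1.1 and the requesting route
are about. Stated over NON-DEGENERATE instance vocabularies `br` (`IsNondegenerateVocab`: some
arity `≥ 1`, so that the table code of an `n`-element instance has length `≥ n`, as for
`fagin_theorem`; the source encodes instances with their universe listed, where this is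
automatic) — then the reduction is the gadget map `gadgetInstance`, of size polynomial in `n`.
The structural half is proved (`hasHomTo_gadgetInstance_iff` with
`HomEquivalent.nonempty_hom_iff`); what is not proved here is that `gadgetInstance` is
polynomial-time computable on codes. Users take `(h : cspLanguage_karpReducible_of_ppConstructs)`.
[cite: BartoOprsalPinsker2017, Cor. 3.5 with Cor. 3.10] -/
def cspLanguage_karpReducible_of_ppConstructs : Prop :=
  ∀ (ar br : List ℕ) (m m' : ℕ) (T : RelTables ar m) (T' : RelTables br m'),
    IsNondegenerateVocab br →
      (letI := structureOfTables T; letI := structureOfTables T';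
        PPConstructs (relLanguage ar) (relLanguage br) (Fin m) (Fin m')) →
      Literature.Computability.Complexity.PolyTimeKarpReducible (cspLanguage T') (cspLanguage T)

end Tables

end Literature.ModelTheory.FiniteModelTheory
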